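import Mathlib
import Summits.ResolutionOfSingularities.ResolutionOfSingularities.Theorems.RadicialJungCleanModelsCleanProp44PointStepCurves
import Summits.ResolutionOfSingularities.ResolutionOfSingularities.Theorems.RadicialJungCleanModelsCleanProp44OfTauOneResidual
import HarnessLib

/-!
# Route `RadicialJung`, crux `CleanModels` (stmt-ResolutionOfSingularities-15917), line `Sketch` rev 35, stub 6 `stub_cleanProp44` (X44c):
# THE `τ = 1` POINT SLICE (R2) FOLLOWS FROM THE CURVE SLICE (R3) — NINTH CUT X44c ⟸ (R1) ∧ (R3)

Seat decomp-res-hand-2 g16 (structural hand), sequel of ✓ `…CleanProp44PointStepCurves.lean` (`exists_bad_near_point_of_curveSlice`: the FULL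
clean point step, near lines handed to the curve slice) and of g11's census ✓ `cleanProp44_of_tauOneResidual : (R1) → (R2) → (R3) → X44c`.

* `exists_next_stage_of_curveSlice` — the step of the descent given (R3) (next stage packaged in an inline `Σ'`-type; no new definition).
* `exists_isCleanPermissibleSeq_lt_comap_of_isolated_tauOne_of_curveSlice` — **(R2) ⟸ (R3)**: the clean `τ = 1` isolated-point slice at EVERY
  isolated `τ = 1` point follows from the clean curve slice (dependent choice over the stages; the marked points of a non-terminating run form
  an infinite `τ = 1` near chain under POINT blowing ups with coincident centres, forbidden by ✓ `CP2008Prop44.stub_T1`).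
* `cleanProp44_of_phaseTwo_of_curveTauOne` — **NINTH CUT: X44c ⟸ (R1) ∧ (R3)** (hypotheses `hphaseTwo`, `hcurveTauOne` of
  ✓ `cleanProp44_of_tauOneResidual` verbatim; (R2) derived).

NET for the planner: the kernel census of stub 6 loses its middle term — X44c ⟸ clean Phase II of reach-tidy (R1) ∧ the clean curve slice through
a `τ = 1` point (R3) (and, by the companion file, (R3ᵛⁿ′)).  RE-LINE proposal: `stub_cleanProp44 := cleanProp44_of_phaseTwo_of_curveTauOne
stub_cleanPhaseTwo stub_cleanCurveTauOne`.

Honest framing: OURS; (R1) and (R3) are NOT proved here; nothing here proves X44c, any case of `CleanModels`, or resolution of singularities in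
characteristic `p`. [cite: CossartPiltant2008, Prop. 4.2 (b), Lemma 4.3, Prop. 4.4 (proof, pp. 10–11), Lemma 4.5]
[cite: CossartJannsenSaito2020, Thm. 13.7] [cite: Piltant2013, Prop. 5.1 (proof, Step 2)]
-/

noncomputable section

set_option linter.dupNamespace false -- mandated namespace of this single-conjunct summit

open CategoryTheory CategoryTheory.Limits AlgebraicGeometry TopologicalSpace IsLocalRing
open Literature.AlgebraicGeometry.Resolution Literature.AlgebraicGeometry.Motives
open Scheme.IdealSheafData
open Summit.ResolutionOfSingularities.ResolutionOfSingularities.Theorems.CP2008Prop44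

namespace Summit.ResolutionOfSingularities.ResolutionOfSingularities.Theorems.RadicialJung.CleanModels

/-! ## §1 The step of the descent given (R3) -/

set_option maxHeartbeats 1600000 in
-- the next stage is packaged in an inline `Σ'`-type (no new definition)
/-- **The step of the points-only descent GIVEN THE CURVE SLICE (R3)**: from a stage `(Y, J, G, W, y)` of the descent — standing hypotheses, `y`
an isolated `τ = 1` closed threefold point of the `m`-stratum of the open `W` with a G-ring stalk, and NO clean sequence on `W` — the full clean point
step ✓ `exists_bad_near_point_of_curveSlice` (near lines settled by `hcurve`) yields the NEXT stage, packaged as a dependent tuple, with its blowing up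
`π`, `π y' = y` and `J' =` the controlled transform. [cite: CossartPiltant2008, Prop. 4.4 (proof, p. 11)] -/
theorem exists_next_stage_of_curveSlice {p : ℕ} (hp : p.Prime) {m : ℕ} (hm : 1 ≤ m)
    (hcurve : ∀ {X : Scheme.{0}} [IsIntegral X] [IsNoetherian X], CharP X.functionField p →
      ∀ (hX : Scheme.IsRegular X), Scheme.IsQuasiExcellent X → topologicalKrullDim X ≤ 3 →
      ∀ (G : X.functionField), (∀ x : X, CleanRegAt p (algebraMap (X.presheaf.stalk x) X.functionField) G) →
      ∀ (J : X.IdealSheafData), (∀ z, idealOrder J z ≤ m) → (∀ z ∈ J.support, 1 < Order.coheight z) →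
      ∀ (V : X.Opens) (Y : Closeds X), Scheme.IsRegular (vanishingIdeal Y).subscheme → IsIrreducible (Y : Set X) →
      (Y : Set X) ⊆ (V : Set X) → (∀ z : X, (m : ℕ∞) ≤ idealOrder J z → z ∈ (Y : Set X) ∨ z ∉ (V : Set X)) →
      (∀ y ∈ (Y : Set X), idealOrder J y = m) →
      (∀ y ∈ (Y : Set X), haveI := hX y; ∃ c : Fin 2 → X.presheaf.stalk y, IsRsopPart c ∧
        Ideal.span (Set.range c) = stalkIdeal (vanishingIdeal Y) y) →
      (¬ ∀ y ∈ (Y : Set X), IsClosed ({y} : Set X) → haveI := hX y; 2 ≤ stalkTau J y m) →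
      ∀ [IsIntegral ((V : X.Opens) : Scheme.{0})] [IsDominant V.ι],
      ∃ (V' : Scheme.{0}) (π : V' ⟶ V) (_ : IsIntegral V') (_ : IsDominant π) (K' : V'.IdealSheafData),
        IsCleanPermissibleSeq p π (J.comap V.ι) m K' (RatFn.functionFieldMap V.ι G) ∧ ∀ y, idealOrder K' y < m)
    (Y : Scheme.{0}) (hYi : IsIntegral Y) (hYn : IsNoetherian Y) (JY : Y.IdealSheafData) (GY : Y.functionField)
      (W : Y.Opens) (y : Y) :
      (CharP Y.functionField p ∧ Scheme.IsRegular Y ∧ Scheme.IsQuasiExcellent Y ∧ topologicalKrullDim Y ≤ 3 ∧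
      (∀ z : Y, CleanRegAt p (algebraMap (Y.presheaf.stalk z) Y.functionField) GY) ∧
      (∀ z, idealOrder JY z ≤ m) ∧ (∀ z ∈ JY.support, 1 < Order.coheight z) ∧ y ∈ W ∧ IsClosed ({y} : Set Y) ∧
      (∀ z : Y, (m : ℕ∞) ≤ idealOrder JY z → z = y ∨ z ∉ (W : Set Y)) ∧ idealOrder JY y = m ∧
      (maximalIdeal (Y.presheaf.stalk y)).spanFinrank = 3 ∧ (∀ h : IsRegularLocalRing (Y.presheaf.stalk y), @stalkTau Y JY y h m = 1) ∧
      IsGRing (Y.presheaf.stalk y) ∧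
      ¬ ∀ [IsIntegral ((W : Y.Opens) : Scheme.{0})] [IsDominant W.ι],
        ∃ (V' : Scheme.{0}) (ϖ : V' ⟶ W) (_ : IsIntegral V') (_ : IsDominant ϖ) (K' : V'.IdealSheafData),
          IsCleanPermissibleSeq p ϖ (JY.comap W.ι) m K' (RatFn.functionFieldMap W.ι GY) ∧ ∀ y, idealOrder K' y < m) →
      ∃ (s' : Σ' (Y : Scheme.{0}) (_ : IsIntegral Y) (_ : IsNoetherian Y) (JY : Y.IdealSheafData) (GY : Y.functionField)
      (W : Y.Opens) (y : Y),
      CharP Y.functionField p ∧ Scheme.IsRegular Y ∧ Scheme.IsQuasiExcellent Y ∧ topologicalKrullDim Y ≤ 3 ∧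
        (∀ z : Y, CleanRegAt p (algebraMap (Y.presheaf.stalk z) Y.functionField) GY) ∧
        (∀ z, idealOrder JY z ≤ m) ∧ (∀ z ∈ JY.support, 1 < Order.coheight z) ∧ y ∈ W ∧ IsClosed ({y} : Set Y) ∧
        (∀ z : Y, (m : ℕ∞) ≤ idealOrder JY z → z = y ∨ z ∉ (W : Set Y)) ∧ idealOrder JY y = m ∧
        (maximalIdeal (Y.presheaf.stalk y)).spanFinrank = 3 ∧ (∀ h : IsRegularLocalRing (Y.presheaf.stalk y), @stalkTau Y JY y h m = 1) ∧
        IsGRing (Y.presheaf.stalk y) ∧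
        ¬ ∀ [IsIntegral ((W : Y.Opens) : Scheme.{0})] [IsDominant W.ι],
          ∃ (V' : Scheme.{0}) (ϖ : V' ⟶ W) (_ : IsIntegral V') (_ : IsDominant ϖ) (K' : V'.IdealSheafData),
            IsCleanPermissibleSeq p ϖ (JY.comap W.ι) m K' (RatFn.functionFieldMap W.ι GY) ∧ ∀ y, idealOrder K' y < m) (hc : IsClosed ({y} : Set Y)) (π : s'.1 ⟶ Y),
        IsBlowup π (vanishingIdeal ⟨{y}, hc⟩) ∧ π s'.2.2.2.2.2.2.1 = y ∧
          s'.2.2.2.1 = controlledTransform π (vanishingIdeal ⟨{y}, hc⟩) JY m := by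
  intro hgood
  obtain ⟨hchar, hYreg, hYqe, hY3, hGY, hleY, hcodimY, hyW, hycl, hbadY, hordY, hdimY, -, -, hbadW⟩ := hgood
  haveI := hchar
  have hb := Literature.AlgebraicGeometry.Resolution.exists_isBlowup Y (vanishingIdeal (⟨{y}, hycl⟩ : Closeds Y))
  rcases hb with ⟨X₁, π, hπ⟩
  have hnext := exists_bad_near_point_of_curveSlice hp hYreg hYqe hY3 GY hGY JY hm hleY hcodimY W y hyW hycl hbadY hordY hdimY π hπ
    hcurve hbadW
  rcases hnext with ⟨hint₁, hnoeth₁, hX₁, hqe₁, hX3₁, hdom₁, hchar₁, hG₁, hle₁, hcodim₁, x', hx'y, -, W', hx'W', -, hx'cl, hbad', hord',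
    hdim', hτ', hGr', hbadW'⟩
  refine ⟨⟨X₁, hint₁, hnoeth₁, controlledTransform π (vanishingIdeal ⟨{y}, hycl⟩) JY m, RatFn.functionFieldMap π GY, W', x', hchar₁,
    hX₁, hqe₁, hX3₁, hG₁, hle₁, hcodim₁, hx'W', hx'cl, hbad', hord', hdim', fun h => hτ', hGr', fun h => hbadW' h⟩, hycl, π, ?_, ?_, ?_⟩
  exacts [hπ, hx'y, rfl]

/-! ## §2 The descent: (R2) ⟸ (R3) -/

set_option maxHeartbeats 3200000 in
-- the chain bookkeeping (an inline `Σ'`-type of stages, no new definition) is long to elaborate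
/-- **THE CLEAN `τ = 1` ISOLATED-POINT SLICE (R2) FOLLOWS FROM THE CLEAN CURVE SLICE (R3).**  Hypothesis `hcurve` = (R3) `hcurveTauOne` of
✓ `cleanProp44_of_tauOneResidual` (binders verbatim, for this `p` and `m`); conclusion = (R2) `htauOne` (binders verbatim).  Proof: if `(V, J|_V, m)`
admits no clean sequence, the full clean point step (`exists_next_stage_of_curveSlice`: near lines are settled by `hcurve`) runs for ever and its
marked points form an infinite chain of `τ = 1` near closed threefold points under POINT blowing ups, centres coincident with `Σ_m` at the chain
point — forbidden by ✓ `CP2008Prop44.stub_T1`. [cite: CossartPiltant2008, Prop. 4.4 (proof, p. 11), Lemma 4.5] [cite: CossartJannsenSaito2020, Thm. 13.7] -/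
theorem exists_isCleanPermissibleSeq_lt_comap_of_isolated_tauOne_of_curveSlice {p : ℕ} (hp : p.Prime) {m : ℕ} (hm : 1 ≤ m)
    (hcurve : ∀ {X : Scheme.{0}} [IsIntegral X] [IsNoetherian X], CharP X.functionField p →
      ∀ (hX : Scheme.IsRegular X), Scheme.IsQuasiExcellent X → topologicalKrullDim X ≤ 3 →
      ∀ (G : X.functionField), (∀ x : X, CleanRegAt p (algebraMap (X.presheaf.stalk x) X.functionField) G) →
      ∀ (J : X.IdealSheafData), (∀ z, idealOrder J z ≤ m) → (∀ z ∈ J.support, 1 < Order.coheight z) →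
      ∀ (V : X.Opens) (Y : Closeds X), Scheme.IsRegular (vanishingIdeal Y).subscheme → IsIrreducible (Y : Set X) →
      (Y : Set X) ⊆ (V : Set X) → (∀ z : X, (m : ℕ∞) ≤ idealOrder J z → z ∈ (Y : Set X) ∨ z ∉ (V : Set X)) →
      (∀ y ∈ (Y : Set X), idealOrder J y = m) →
      (∀ y ∈ (Y : Set X), haveI := hX y; ∃ c : Fin 2 → X.presheaf.stalk y, IsRsopPart c ∧
        Ideal.span (Set.range c) = stalkIdeal (vanishingIdeal Y) y) →
      (¬ ∀ y ∈ (Y : Set X), IsClosed ({y} : Set X) → haveI := hX y; 2 ≤ stalkTau J y m) →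
      ∀ [IsIntegral ((V : X.Opens) : Scheme.{0})] [IsDominant V.ι],
      ∃ (V' : Scheme.{0}) (π : V' ⟶ V) (_ : IsIntegral V') (_ : IsDominant π) (K' : V'.IdealSheafData),
        IsCleanPermissibleSeq p π (J.comap V.ι) m K' (RatFn.functionFieldMap V.ι G) ∧ ∀ y, idealOrder K' y < m)
    {X : Scheme.{0}} [IsIntegral X] [IsNoetherian X] [hcharX : CharP X.functionField p] (hX : Scheme.IsRegular X)
    (hqe : Scheme.IsQuasiExcellent X) (hX3 : topologicalKrullDim X ≤ 3) (G : X.functionField)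
    (hG : ∀ x : X, CleanRegAt p (algebraMap (X.presheaf.stalk x) X.functionField) G)
    (J : X.IdealSheafData) (hle : ∀ z, idealOrder J z ≤ m) (hcodim : ∀ z ∈ J.support, 1 < Order.coheight z)
    (V : X.Opens) (x : X) (hxV : x ∈ V) (hcl : IsClosed ({x} : Set X))
    (hbad : ∀ z : X, (m : ℕ∞) ≤ idealOrder J z → z = x ∨ z ∉ (V : Set X)) (hord : idealOrder J x = m)
    (hdim : (maximalIdeal (X.presheaf.stalk x)).spanFinrank = 3) (hτ : haveI := hX x; stalkTau J x m = 1)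
    (hGr : IsGRing (X.presheaf.stalk x)) [IsIntegral ((V : X.Opens) : Scheme.{0})] [IsDominant V.ι] :
    ∃ (V' : Scheme.{0}) (π : V' ⟶ V) (_ : IsIntegral V') (_ : IsDominant π) (K' : V'.IdealSheafData),
      IsCleanPermissibleSeq p π (J.comap V.ι) m K' (RatFn.functionFieldMap V.ι G) ∧ ∀ y, idealOrder K' y < m := by
  classical
  by_contra hnot
  -- the stages of the descent: `(Y, J, G, W, y)` with the standing hypotheses, `y` an isolated `τ = 1` point of the `m`-stratum of the open `W`
  -- (closed, threefold, G-ring), and NO clean sequence on `W` (an inline `Σ'`-type — the one of `exists_next_stage_of_nearLine`; no definition)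
  let St : Type 1 := Σ' (Y : Scheme.{0}) (_ : IsIntegral Y) (_ : IsNoetherian Y) (JY : Y.IdealSheafData) (GY : Y.functionField)
    (W : Y.Opens) (y : Y),
    CharP Y.functionField p ∧ Scheme.IsRegular Y ∧ Scheme.IsQuasiExcellent Y ∧ topologicalKrullDim Y ≤ 3 ∧
      (∀ z : Y, CleanRegAt p (algebraMap (Y.presheaf.stalk z) Y.functionField) GY) ∧
      (∀ z, idealOrder JY z ≤ m) ∧ (∀ z ∈ JY.support, 1 < Order.coheight z) ∧ y ∈ W ∧ IsClosed ({y} : Set Y) ∧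
      (∀ z : Y, (m : ℕ∞) ≤ idealOrder JY z → z = y ∨ z ∉ (W : Set Y)) ∧ idealOrder JY y = m ∧
      (maximalIdeal (Y.presheaf.stalk y)).spanFinrank = 3 ∧ (∀ h : IsRegularLocalRing (Y.presheaf.stalk y), @stalkTau Y JY y h m = 1) ∧
      IsGRing (Y.presheaf.stalk y) ∧
      ¬ ∀ [IsIntegral ((W : Y.Opens) : Scheme.{0})] [IsDominant W.ι],
        ∃ (V' : Scheme.{0}) (ϖ : V' ⟶ W) (_ : IsIntegral V') (_ : IsDominant ϖ) (K' : V'.IdealSheafData),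
          IsCleanPermissibleSeq p ϖ (JY.comap W.ι) m K' (RatFn.functionFieldMap W.ι GY) ∧ ∀ y, idealOrder K' y < m
  let s₀ : St := ⟨X, inferInstance, inferInstance, J, G, V, x, hcharX, hX, hqe, hX3, hG, hle, hcodim, hxV, hcl, hbad, hord, hdim,
    fun h => hτ, hGr, fun h => hnot h⟩
  -- THE STEP on bundled stages
  have hstep : ∀ s : St, ∃ (s' : St) (hc : IsClosed ({s.2.2.2.2.2.2.1} : Set s.1)) (π : s'.1 ⟶ s.1),
      IsBlowup π (vanishingIdeal ⟨{s.2.2.2.2.2.2.1}, hc⟩) ∧ π s'.2.2.2.2.2.2.1 = s.2.2.2.2.2.2.1 ∧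
        s'.2.2.2.1 = controlledTransform π (vanishingIdeal ⟨{s.2.2.2.2.2.2.1}, hc⟩) s.2.2.2.1 m := fun s =>
    exists_next_stage_of_curveSlice hp hm hcurve s.1 s.2.1 s.2.2.1 s.2.2.2.1 s.2.2.2.2.1 s.2.2.2.2.2.1 s.2.2.2.2.2.2.1 s.2.2.2.2.2.2.2
  -- THE CHAIN: dependent choice over the stages (the sequence `f` is then made opaque)
  choose g hg using hstep
  have hseq : ∃ f : ℕ → St, ∀ n, ∃ (hc : IsClosed ({(f n).2.2.2.2.2.2.1} : Set (f n).1)) (π : (f (n + 1)).1 ⟶ (f n).1),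
      IsBlowup π (vanishingIdeal ⟨{(f n).2.2.2.2.2.2.1}, hc⟩) ∧ π (f (n + 1)).2.2.2.2.2.2.1 = (f n).2.2.2.2.2.2.1 ∧
        (f (n + 1)).2.2.2.1 = controlledTransform π (vanishingIdeal ⟨{(f n).2.2.2.2.2.2.1}, hc⟩) (f n).2.2.2.1 m :=
    ⟨fun n => Nat.rec (motive := fun _ => St) s₀ (fun _ s => g s) n, fun n => hg _⟩
  rcases hseq with ⟨f, hf⟩
  choose hgc hgπ hgblow hgpt hgJ using hf
  -- the data of ✓ `stub_T1`, made opaque (only the `G`-free fields of the stages are kept)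
  have hpack : ∃ (Xs : ℕ → Scheme.{0}) (_ : ∀ n, IsIntegral (Xs n)) (_ : ∀ n, IsNoetherian (Xs n)) (Js : ∀ n, (Xs n).IdealSheafData)
      (Ws : ∀ n, (Xs n).Opens) (pt : ∀ n, Xs n) (πs : ∀ n, Xs (n + 1) ⟶ Xs n) (_ : ∀ n, Scheme.IsRegular (Xs n))
      (_ : ∀ n z, idealOrder (Js n) z ≤ m) (_ : ∀ n, ∀ z ∈ (Js n).support, 1 < Order.coheight z) (_ : ∀ n, pt n ∈ Ws n)
      (_ : ∀ n (z : Xs n), (m : ℕ∞) ≤ idealOrder (Js n) z → z = pt n ∨ z ∉ (Ws n : Set (Xs n))) (_ : ∀ n, idealOrder (Js n) (pt n) = m)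
      (_ : ∀ n, (maximalIdeal ((Xs n).presheaf.stalk (pt n))).spanFinrank = 3)
      (_ : ∀ n, ∀ h : IsRegularLocalRing ((Xs n).presheaf.stalk (pt n)), @stalkTau (Xs n) (Js n) (pt n) h m = 1)
      (_ : ∀ n, IsGRing ((Xs n).presheaf.stalk (pt n)))
      (hptcl : ∀ n, IsClosed ({pt n} : Set (Xs n))),
        (∀ n, IsBlowup (πs n) (vanishingIdeal ⟨{pt n}, hptcl n⟩)) ∧ (∀ n, πs n (pt (n + 1)) = pt n) ∧
          (∀ n, Js (n + 1) = controlledTransform (πs n) (vanishingIdeal ⟨{pt n}, hptcl n⟩) (Js n) m) :=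
    ⟨fun n => (f n).1, fun n => (f n).2.1, fun n => (f n).2.2.1, fun n => (f n).2.2.2.1,
      fun n => (f n).2.2.2.2.2.1, fun n => (f n).2.2.2.2.2.2.1, hgπ, fun n => (f n).2.2.2.2.2.2.2.2.1,
      fun n => (f n).2.2.2.2.2.2.2.2.2.2.2.2.1, fun n => (f n).2.2.2.2.2.2.2.2.2.2.2.2.2.1, fun n => (f n).2.2.2.2.2.2.2.2.2.2.2.2.2.2.1,
      fun n => (f n).2.2.2.2.2.2.2.2.2.2.2.2.2.2.2.2.1, fun n => (f n).2.2.2.2.2.2.2.2.2.2.2.2.2.2.2.2.2.1,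
      fun n => (f n).2.2.2.2.2.2.2.2.2.2.2.2.2.2.2.2.2.2.1, fun n => (f n).2.2.2.2.2.2.2.2.2.2.2.2.2.2.2.2.2.2.2.1,
      fun n => (f n).2.2.2.2.2.2.2.2.2.2.2.2.2.2.2.2.2.2.2.2.1, hgc, hgblow, hgpt, hgJ⟩
  rcases hpack with ⟨Xs, hint, hnoeth, Js, Ws, pt, πs, hXreg, hle', hcodim', hptW, hbad', hord', hdim', hτ', hGr', hptcl, hπblow, hπpt,
    hπJ⟩
  have hN : ∀ n, IsLocallyNoetherian (Xs n) := fun n => inferInstance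
  let Ys : ∀ n, Closeds (Xs n) := fun n => ⟨{pt n}, hptcl n⟩
  let ys : ∀ n, Xs (n + 1) := fun n => pt (n + 1)
  refine stub_T1 Xs hN hXreg πs Ys ys Js hm (fun n => ?_) (fun n => ?_) (fun n => ?_) (fun n => isIrreducible_singleton)
    (fun n => CampaignW46.isRegular_subscheme_vanishingIdeal_singleton (hptcl n)) (fun n z hz => ?_) (fun n => hπblow n)
    (fun n => hπJ n) (fun n z => hle' n z) (fun n z hz => hcodim' n z hz) (fun n => ?_)
    (fun n => ?_) (fun n => ?_) (fun n => ?_) (fun n z hz hordz => ?_)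
  · -- `hy`
    show πs (n + 1) (pt (n + 1 + 1)) = pt (n + 1)
    exact hπpt (n + 1)
  · -- `hmem`
    show πs n (pt (n + 1)) ∈ ({pt n} : Set (Xs n))
    rw [hπpt n]
    exact Set.mem_singleton _
  · -- `hcl`
    show IsClosed ({πs n (pt (n + 1))} : Set (Xs n))
    rw [hπpt n]
    exact hptcl n
  · -- `hYord`
    have hz' : z = pt n := hz
    rw [hz']
    exact hord' n
  · -- `hd`
    show (maximalIdeal ((Xs n).presheaf.stalk (πs n (pt (n + 1))))).spanFinrank = 3
    rw [hπpt n]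
    exact hdim' n
  · -- `hnear`
    refine isNear_iff.mpr ?_
    show idealOrder (controlledTransform (πs n) (vanishingIdeal ⟨{pt n}, hptcl n⟩) (Js n) m) (pt (n + 1)) = m
    have h : idealOrder (Js (n + 1)) (pt (n + 1)) = m := hord' (n + 1)
    rw [hπJ n] at h
    exact h
  · -- `hτ`
    have h := hτ' n
    have key : ∀ (w : Xs n) (hw : w = pt n) (hr : IsRegularLocalRing ((Xs n).presheaf.stalk w)), @stalkTau (Xs n) (Js n) w hr m = 1 := by
      intro w hw hr
      subst hw
      exact h hr
    exact key _ (hπpt n) _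
  · -- `hG`
    show IsGRing ((Xs n).presheaf.stalk (πs n (pt (n + 1))))
    rw [hπpt n]
    exact hGr' n
  · -- `hcoinc`: the chain point is isolated in its open, so every order-`m` generization of it is the point itself
    show z ∈ ({pt n} : Set (Xs n))
    have hz' : z ⤳ pt n := by
      have e : πs n (ys n) = pt n := hπpt n
      rw [e] at hz
      exact hz
    have hzW : z ∈ (Ws n : Set (Xs n)) := hz'.mem_open (Ws n).2 (hptW n)
    rcases hbad' n z hordz.ge with h | h
    · exact h
    · exact absurd hzW h

/-! ## §3 NINTH CUT: X44c ⟸ (R1) ∧ (R3) — the point slice is gone -/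

set_option maxHeartbeats 1600000 in
-- long binder lists
/-- **THE CLEAN ASSEMBLY, NINTH CUT: X44c (`stub_cleanProp44`, verbatim) ⟸ (R1) clean Phase II of reach-tidy ∧ (R3) the clean curve slice through a
`τ = 1` point** — the hypotheses `hphaseTwo` and `hcurveTauOne` of ✓ `cleanProp44_of_tauOneResidual` VERBATIM, its middle hypothesis (R2) `htauOne`
being DERIVED (`exists_isCleanPermissibleSeq_lt_comap_of_isolated_tauOne_of_curveSlice`). [cite: CossartPiltant2008, Prop. 4.4, Lemma 4.5]
[cite: CossartJannsenSaito2020, Thm. 13.7] [cite: Piltant2013, Prop. 5.1 (proof, Step 2)] -/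
theorem cleanProp44_of_phaseTwo_of_curveTauOne
    (hphaseTwo : ∀ (p : ℕ), p.Prime → ∀ {X : Scheme.{0}} [IsIntegral X] [IsNoetherian X], CharP X.functionField p →
      ∀ (hX : Scheme.IsRegular X), Scheme.IsQuasiExcellent X → topologicalKrullDim X ≤ 3 →
      ∀ (G : X.functionField), (∀ x : X, CleanRegAt p (algebraMap (X.presheaf.stalk x) X.functionField) G) →
      ∀ (J : X.IdealSheafData) {μ : ℕ}, 1 ≤ μ → (∀ z, idealOrder J z ≤ μ) → (∀ z ∈ J.support, 1 < Order.coheight z) →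
      (∀ x : X, ¬ ∃ C ∈ {C : Closeds X | ∃ ζ ∈ maxPoints {z : X | (μ : ℕ∞) ≤ idealOrder J z},
          ¬ IsClosed ({ζ} : Set X) ∧ C = ⟨closure {ζ}, isClosed_closure⟩},
        x ∈ (vanishingIdeal C).subschemeι '' (Scheme.regularLocus (vanishingIdeal C).subscheme)ᶜ ∨
        (x ∈ (C : Set X) ∧ ∃ C' ∈ {C : Closeds X | ∃ ζ ∈ maxPoints {z : X | (μ : ℕ∞) ≤ idealOrder J z},
            ¬ IsClosed ({ζ} : Set X) ∧ C = ⟨closure {ζ}, isClosed_closure⟩}, C' ≠ C ∧ x ∈ (C' : Set X) ∧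
          stalkIdeal (vanishingIdeal C) x ⊔ stalkIdeal (vanishingIdeal C') x ≠ maximalIdeal (X.presheaf.stalk x))) →
      ∃ (X₁ : Scheme.{0}) (Φ : X₁ ⟶ X) (_ : IsIntegral X₁) (_ : IsDominant Φ) (J₁ : X₁.IdealSheafData)
        (_ : IsCleanPermissibleSeq p Φ J μ J₁ G),
        (∀ ζ : X₁, (μ : ℕ∞) ≤ idealOrder J₁ ζ → Order.coheight ζ = 2 → ¬ IsClosed ({ζ} : Set X₁) →
            Scheme.IsRegular (vanishingIdeal (⟨closure {ζ}, isClosed_closure⟩ : Closeds X₁)).subscheme) ∧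
        (∀ ζ₁ ζ₂ : X₁, (μ : ℕ∞) ≤ idealOrder J₁ ζ₁ → Order.coheight ζ₁ = 2 → ¬ IsClosed ({ζ₁} : Set X₁) →
            (μ : ℕ∞) ≤ idealOrder J₁ ζ₂ → Order.coheight ζ₂ = 2 → ¬ IsClosed ({ζ₂} : Set X₁) → ζ₁ ≠ ζ₂ →
            Disjoint (closure ({ζ₁} : Set X₁)) (closure {ζ₂})))
    (hcurveTauOne : ∀ (p : ℕ), p.Prime → ∀ {X : Scheme.{0}} [IsIntegral X] [IsNoetherian X], CharP X.functionField p →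
      ∀ (hX : Scheme.IsRegular X), Scheme.IsQuasiExcellent X → topologicalKrullDim X ≤ 3 →
      ∀ (G : X.functionField), (∀ x : X, CleanRegAt p (algebraMap (X.presheaf.stalk x) X.functionField) G) →
      ∀ (J : X.IdealSheafData) {m : ℕ}, 1 ≤ m → (∀ z, idealOrder J z ≤ m) → (∀ z ∈ J.support, 1 < Order.coheight z) →
      ∀ (V : X.Opens) (Y : Closeds X), Scheme.IsRegular (vanishingIdeal Y).subscheme → IsIrreducible (Y : Set X) →
      (Y : Set X) ⊆ (V : Set X) → (∀ z : X, (m : ℕ∞) ≤ idealOrder J z → z ∈ (Y : Set X) ∨ z ∉ (V : Set X)) →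
      (∀ y ∈ (Y : Set X), idealOrder J y = m) →
      (∀ y ∈ (Y : Set X), haveI := hX y; ∃ c : Fin 2 → X.presheaf.stalk y, IsRsopPart c ∧
        Ideal.span (Set.range c) = stalkIdeal (vanishingIdeal Y) y) →
      (¬ ∀ y ∈ (Y : Set X), IsClosed ({y} : Set X) → haveI := hX y; 2 ≤ stalkTau J y m) →
      ∀ [IsIntegral ((V : X.Opens) : Scheme.{0})] [IsDominant V.ι],
      ∃ (V' : Scheme.{0}) (π : V' ⟶ V) (_ : IsIntegral V') (_ : IsDominant π) (K' : V'.IdealSheafData),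
        IsCleanPermissibleSeq p π (J.comap V.ι) m K' (RatFn.functionFieldMap V.ι G) ∧ ∀ y, idealOrder K' y < m) :
    ∀ (p : ℕ), p.Prime → ∀ (S : Scheme.{0}) [IsIntegral S] [IsNoetherian S],
      CharP S.functionField p → Scheme.IsRegular S → Scheme.IsExcellent S → topologicalKrullDim S = 3 →
      ∀ G₀ : S.functionField, (∀ s : S, CleanRegAt p (algebraMap (S.presheaf.stalk s) S.functionField) G₀) →
      ∀ I : S.IdealSheafData, I ≠ ⊥ →
      ∀ (X : Scheme.{0}) (ρ : X ⟶ S) [IsIntegral X] [IsNoetherian X] [IsDominant ρ],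
        IsCleanRegularCentreBlowupSeq p ρ I G₀ →
        (∀ x : X, CleanRegAt p (algebraMap (X.presheaf.stalk x) X.functionField) (RatFn.functionFieldMap ρ G₀)) →
        ∀ (J : X.IdealSheafData) (μ : ℕ), 1 ≤ μ →
          (∀ x ∈ J.support, 1 < Order.coheight x) → (∀ x, idealOrder J x ≤ μ) → (∃ x, idealOrder J x = μ) →
          ∃ (X' : Scheme.{0}) (π : X' ⟶ X) (_ : IsIntegral X') (_ : IsDominant π) (J' : X'.IdealSheafData),
            IsCleanPermissibleSeq p π J μ J' (RatFn.functionFieldMap ρ G₀) ∧ ∀ x, idealOrder J' x < μ := by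
  refine cleanProp44_of_tauOneResidual hphaseTwo ?_ hcurveTauOne
  intro p hp X _ _ hchar hX hqe hX3 G hG J m hm hle hcodim V x hxV hcl hbad hord hdim hτ hGr _ _
  haveI := hchar
  exact exists_isCleanPermissibleSeq_lt_comap_of_isolated_tauOne_of_curveSlice hp hm
    (fun hch hY hYqe hY3 GY hGY JY hleY hcodY W C hCreg hCirr hCW hJC hordC hrsop hτ2 =>
      hcurveTauOne p hp hch hY hYqe hY3 GY hGY JY hm hleY hcodY W C hCreg hCirr hCW hJC hordC hrsop hτ2)
    hX hqe hX3 G hG J hle hcodim V x hxV hcl hbad hord hdim hτ hGr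

end Summit.ResolutionOfSingularities.ResolutionOfSingularities.Theorems.RadicialJung.CleanModels

end
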